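import Summits.ResolutionOfSingularities.ResolutionOfSingularities.Theorems.DeltaCutChain3
import HarnessLib

/-!
# DeltaCutChainCertificates — decomp-res node «ChainCut» (lens-6 g24, critic row 185 CLEARED DECIDED +1 · MAP 0),
tree file 4/5 of the node

Content VERBATIM from the decomp-res lens-6 g24 node `HOME/decomp-res-lens-6/g24/ChainCut.lean` (pin dd25c369;
imports the landed tree only, carries nothing); HOME = run/shared/lean/pub/decomp-res; critic row 185 CLEARED
DECIDED +1 · MAP 0; landing orders INBOX :962/:964/:980 — provenance, critic text and the lens header in full in the
first file of the node, `DeltaCutChain`.  Namespace `…Theorems.DeltaCutClasses`; `--supports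
stmt-ResolutionOfSingularities-26971`.

## This file

§S KERNEL CERTIFICATES of the chain cut (node l. 675–1165; polynomial level, char 3, `n = 3`, format of g23 §R-c
`DeltaCutCertificates`): `section ChainCertificates` — DECIDED side: g23's δ-heavy inhabitant R2 = `z³+t⁴+u²w²`
LEAVES the residual (`R2_chainTame_certificate`: Sing₃ = the origin, near points = the two chart origins, both
TAME); RESIDUAL side, finite-chain kind: B_S = `z³+t⁷+u⁷+w⁷` (`BS_chain_certificate`: a δ-heavy WILD near-point
chain of length 2); infinite kind: C_ax = `z³+t⁴+u⁴` (`Cax_curve_certificate`: the whole `w`-axis consists of bad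
points).  (This first part carries: `f_self`, `f_ne`, `f_two`, `f_one`, `sq_mul_deriv_mem_pow`,
`mem_of_mul_mul_pow_mem_pow`, `natCast_not_mem`, `pow_not_mem`, `spanX4_ne_top`, `X_not_mem_spanX4_sq`,
`X_mem_spanX4`, `R2_isolated`, `R2_near_chart_u_only`, `R2_near_chart_w_only`, `R2_noNear_chart_t`, `R2_noNear_chart_z`.)

[WRITER NOTE (decomp-res writer g12): file split only (tree files ≤ 400 lines); namespace, sections, section
variables / opens and every declaration exactly as in the lens (the node's global dupNamespace-linter line is
dropped — the library sets it). The four chart lemmas `f_self` / `f_ne` / `f_two` / `f_one` of `section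
chart_lemmas4` lose their `private` modifier — the only non-verbatim token change: `DeltaCutChainCertificates2` uses
them across the file split and `private` names do not cross module boundaries (no name clash in `…DeltaCutClasses`).]

(Sources: Hironaka1967 (characteristic polyhedra); CossartJannsenSaito2020 Def. 3.13 / Thm. 3.14, Ch. 8, Thm. 9.6;
Hironaka1970 (near points / vertices); CossartPiltant2019 Prop. 2.6 (δ at chart origins); CossartPiltant2008 §2;
Giraud1975; Hironaka2005 (three key theorems: order under permissible blow-up); EGAIV4 §16–§17; StacksProject 0804 /
0BIQ / 031I; Matsumura1987 §28.)
-/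

noncomputable section

open CategoryTheory CategoryTheory.Limits AlgebraicGeometry TopologicalSpace IsLocalRing
open Literature.AlgebraicGeometry.Resolution

universe u

namespace Summit.ResolutionOfSingularities.ResolutionOfSingularities.Theorems.DeltaCutClasses

open Summit.ResolutionOfSingularities.ResolutionOfSingularities.Theorems.TwistCutClasses
open Summit.ResolutionOfSingularities.ResolutionOfSingularities.Theorems.LightCutClasses

section ChainCertificates

open MvPolynomial
variable {K : Type*} [Field K]

section chart_lemmas4

variable (K)

/-! ### KERNEL CERTIFICATES of the chain cut (polynomial level, format of §R-c `CertificatesN`)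

Dictionary.  Downstairs `K[z,t,u,w] = MvPolynomial (Fin 4) K`, `0 = z, 1 = t, 2 = u, 3 = w`, origin `𝔫₀ =
(X₀,X₁,X₂,X₃)`, `n = 3`,
`char K = 3`.  «`ord_𝔮 g ≥ m`» at a prime `𝔮` is read `∃ s ∉ 𝔮, s·g ∈ 𝔮^m` (as in `R3_heavy_and_nearPointFree`,
`R2_near_chart_u`).
Rees charts of the blow-up of `𝔫₀`: chart `xᵢ` has coordinates `xⱼ' = xⱼ/xᵢ (j ≠ i)`, `xᵢ`, and `f = xᵢ³ · f'ᵢ`.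
* R2 = `z³ + t⁴ + u²w²` (g23's δ-HEAVY residual inhabitant) is CHAIN-TAME ⟹ DECIDED by g24 (`R2_chainTame_certificate`):
  (I) Sing₃ = {origin} — every prime of order `≥ 3` contains `𝔫₀` (ONE bad point at most: the finiteness letter holds);
  (II) its near points are EXACTLY the origins of the charts `u` and `w` (charts `t`, `z`: none; charts `u`, `w`:
only the origin);
  (III) both near points are TAME (absolute contact): `∂²_{w'} f'ᵤ = 2u`, `∂²_{u'} f'_w = 2w` extract the exceptional parameter,
  which lies in `𝔫 ∖ 𝔫²` — so R2 has NO WILD near point and the chain letter holds vacuously.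
* B_S = `z³ + t⁷ + u⁷ + w⁷` (g21's residual B-example) is FINITE-CHAIN-HEAVY ⟹ RESIDUAL (`BS_chain_certificate`): (I) Sing₃ =
  {origin} as for R2 (finitely many bad points); (II) the chart-`t` origin `y'` is a near point (`f'_t = z'³ + t⁴(1
+ u'⁷ + w'⁷) ∈ 𝔫'³`) in `3`-POWER FORM `z'³ + (𝔫'⁴)`
  (WILD, tree dictionary `HugValuationCut.isAbsContactAt_iff_not_pPowerFormAt_closed`,
Theorems/ContactFreeIsPPower); (III) `y'` HAS a near point: the chart-`u'` origin
  `y''` of the blow-up at `y'` (`f'' = z''³ + u' t''⁴ (1 + u'⁷ + u'⁷ w''⁷) ∈ 𝔫''³`) — a δ-heavy WILD near-point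
chain of length 2.
* C_ax = `z³ + t⁴ + u⁴` inhabits the CURVE sub-cell (`Cax_curve_certificate`): `f ∈ P³` for the NON-maximal prime `P
= (z,t,u) ∌ w`
  (the whole `w`-axis lies in the top locus), `3`-power form `z³ + P⁴` (wild at EVERY point of the axis), near point
in chart `w` over
  every closed point of the axis (`X₃` read as its local parameter): INFINITELY MANY bad points.
WILDNESS AT A CHART PRIME (the one new certificate shape, dictionary): a chart prime `𝔮 ∋` (exceptional parameter)
of the Rees chart
ring IS a point `y'` of the blow-up over the centre ((N) `exists_point_of_reesChart_prime`), the chart ring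
localised at `𝔮` is the
stalk at `y'`, and «`f' = z'³ + (𝔮⁴)` with `z'` a regular parameter» is the `3`-POWER FORM of the transform at `y'`,
i.e. NO absolute
stalk contact (`¬ IsAbsContactAt`, tree dictionary `HugValuationCut.isAbsContactAt_iff_not_pPowerFormAt_closed`,
Theorems/ContactFreeIsPPower): `y'` is WILD. -/

/-- `f_self`: Auxiliary step of this node's calculus, VERBATIM from the lens file (see the module docstring); the
statement is its type. [folklore] -/
theorem f_self (i : Fin 4) : pderiv i (X i : MvPolynomial (Fin 4) K) = 1 := by
  classical
  exact pderiv_X_self i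

/-- `f_ne`: Auxiliary step of this node's calculus, VERBATIM from the lens file (see the module docstring); the
statement is its type. [folklore] -/
theorem f_ne {i j : Fin 4} (h : j ≠ i) : pderiv i (X j : MvPolynomial (Fin 4) K) = 0 := by
  classical
  exact pderiv_X_of_ne h

/-- `f_two`: Auxiliary step of this node's calculus, VERBATIM from the lens file (see the module docstring); the
statement is its type. [folklore] -/
theorem f_two (i : Fin 4) : pderiv i (2 : MvPolynomial (Fin 4) K) = 0 := by
  have := (pderiv i : Derivation K (MvPolynomial (Fin 4) K) _).map_natCast 2
  exact_mod_cast this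

/-- `f_one`: Auxiliary step of this node's calculus, VERBATIM from the lens file (see the module docstring); the
statement is its type. [folklore] -/
theorem f_one (i : Fin 4) : pderiv i (1 : MvPolynomial (Fin 4) K) = 0 :=
  (pderiv i : Derivation K (MvPolynomial (Fin 4) K) _).map_one_eq_zero

end chart_lemmas4

/-- **`s·g ∈ 𝔮^{m+1} ⟹ s²·Dg ∈ 𝔮^m`** for every derivation `D` (the symbolic-power form of «derivations lower the order by one»:
`s·D(sg) = s²·Dg + (sg)·Ds`). [elementary] [folklore] -/
theorem sq_mul_deriv_mem_pow {R A : Type*} [CommSemiring R] [CommRing A] [Algebra R A] (𝔮 : Ideal A) {s g : A} {m : ℕ}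
    (hsg : s * g ∈ 𝔮 ^ (m + 1)) (D : Derivation R A A) : s ^ 2 * D g ∈ 𝔮 ^ m := by
  have h1 : D (s * g) ∈ 𝔮 ^ m := derivation_pow_succ_mem D 𝔮 m hsg
  have h2 : s * g * D s ∈ 𝔮 ^ m := Ideal.mul_mem_right _ _ (Ideal.pow_le_pow_right (Nat.le_succ m) hsg)
  have h3 : s * D (s * g) - s * g * D s ∈ 𝔮 ^ m := Ideal.sub_mem _ (Ideal.mul_mem_left _ s h1) h2
  rw [Derivation.leibniz, smul_eq_mul, smul_eq_mul] at h3
  rwa [show s * (s * D g + g * D s) - s * g * D s = s ^ 2 * D g by ring] at h3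

/-- From `S·(c·x^k) ∈ 𝔮^m` (`m ≠ 0`) with `S, c ∉ 𝔮` prime: `x ∈ 𝔮`. [elementary] [folklore] -/
theorem mem_of_mul_mul_pow_mem_pow {A : Type*} [CommRing A] (𝔮 : Ideal A) [h𝔮 : 𝔮.IsPrime] {S c x : A} {k m : ℕ}
    (hm : m ≠ 0) (hS : S ∉ 𝔮) (hc : c ∉ 𝔮) (h : S * (c * x ^ k) ∈ 𝔮 ^ m) : x ∈ 𝔮 := by
  have h' : S * (c * x ^ k) ∈ 𝔮 := Ideal.pow_le_self hm h
  rcases h𝔮.mem_or_mem h' with h1 | h1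
  · exact absurd h1 hS
  rcases h𝔮.mem_or_mem h1 with h2 | h2
  · exact absurd h2 hc
  · exact h𝔮.mem_of_pow_mem k h2

/-- In characteristic `3`, a natural number prime to `3` lies in no prime ideal of a polynomial ring. [folklore] -/
theorem natCast_not_mem [CharP K 3] {σ : Type*} (𝔫 : Ideal (MvPolynomial σ K)) [h𝔫 : 𝔫.IsPrime] {m : ℕ} (hm : ¬ 3 ∣ m) :
    (m : MvPolynomial σ K) ∉ 𝔫 := by
  intro h
  have h2 : (m : K) ≠ 0 := fun h0 => hm ((CharP.cast_eq_zero_iff K 3 m).1 h0)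
  have hu : IsUnit (m : MvPolynomial σ K) := by
    have := h2.isUnit.map (C : K →+* MvPolynomial σ K)
    rwa [map_natCast] at this
  exact h𝔫.ne_top (Ideal.eq_top_of_isUnit_mem _ h hu)

/-- Powers of an element outside a prime stay outside. [elementary] [folklore] -/
theorem pow_not_mem {A : Type*} [CommSemiring A] (𝔮 : Ideal A) [h𝔮 : 𝔮.IsPrime] {s : A} (hs : s ∉ 𝔮) (k : ℕ) : s ^ k ∉ 𝔮 :=
  fun h => hs (h𝔮.mem_of_pow_mem k h)

/-- The origin `𝔫₀ = (X₀, X₁, X₂, X₃)` is a proper ideal (it lies in the kernel of evaluation at `0`). [elementary]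
[folklore] -/
theorem spanX4_ne_top : Ideal.span {(X 0 : MvPolynomial (Fin 4) K), X 1, X 2, X 3} ≠ ⊤ := by
  intro h
  have hle : Ideal.span {(X 0 : MvPolynomial (Fin 4) K), X 1, X 2, X 3} ≤ RingHom.ker (eval (0 : Fin 4 → K)) := by
    refine Ideal.span_le.2 ?_
    rintro q hq
    simp only [Set.mem_insert_iff, Set.mem_singleton_iff] at hq
    rcases hq with rfl | rfl | rfl | rfl <;> simp [RingHom.mem_ker]
  have h1 : (1 : MvPolynomial (Fin 4) K) ∈ RingHom.ker (eval (0 : Fin 4 → K)) := hle (h ▸ Submodule.mem_top)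
  rw [RingHom.mem_ker, map_one] at h1
  exact one_ne_zero h1

/-- A coordinate is a REGULAR PARAMETER at the origin: `Xᵢ ∉ 𝔫₀²` (else `∂ᵢ Xᵢ = 1 ∈ 𝔫₀`). [elementary] [folklore] -/
theorem X_not_mem_spanX4_sq (i : Fin 4) :
    (X i : MvPolynomial (Fin 4) K) ∉ (Ideal.span {(X 0 : MvPolynomial (Fin 4) K), X 1, X 2, X 3}) ^ 2 := by
  intro h
  have h1 := derivation_pow_succ_mem (pderiv i : Derivation K (MvPolynomial (Fin 4) K) _) _ 1 h
  rw [f_self, pow_one] at h1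
  exact spanX4_ne_top (K := K) ((Ideal.eq_top_iff_one _).2 h1)

/-- Membership of the coordinates in the origin. [elementary] [folklore] -/
theorem X_mem_spanX4 (j : Fin 4) :
    (X j : MvPolynomial (Fin 4) K) ∈ Ideal.span {(X 0 : MvPolynomial (Fin 4) K), X 1, X 2, X 3} := by
  fin_cases j <;> exact Ideal.subset_span (by simp)

/-! #### R2 = `z³ + t⁴ + u²w²`: Sing₃ = {0}, near points = the two chart origins, both TAME -/

/-- **R2 (I) — Sing₃(R2) = {0}**: every prime `𝔮` of `K[z,t,u,w]` with `ord_𝔮(z³ + t⁴ + u²w²) ≥ 3` contains `z, t, u, w`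
(`∂_t f = 4t³`, `∂²_w f = 2u²`, `∂²_u f = 2w²`, then `z³ ∈ 𝔮`). [new; elementary] [folklore] -/
theorem R2_isolated [CharP K 3] (𝔮 : Ideal (MvPolynomial (Fin 4) K)) [𝔮.IsPrime] {s : MvPolynomial (Fin 4) K}
    (hs : s ∉ 𝔮) (h : s * (X 0 ^ 3 + X 1 ^ 4 + X 2 ^ 2 * X 3 ^ 2 : MvPolynomial (Fin 4) K) ∈ 𝔮 ^ 3) :
    (X 0 : MvPolynomial (Fin 4) K) ∈ 𝔮 ∧ (X 1 : MvPolynomial (Fin 4) K) ∈ 𝔮 ∧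
      (X 2 : MvPolynomial (Fin 4) K) ∈ 𝔮 ∧ (X 3 : MvPolynomial (Fin 4) K) ∈ 𝔮 := by
  have hs2 : s ^ 2 ∉ 𝔮 := pow_not_mem 𝔮 hs 2
  have hs4 : (s ^ 2) ^ 2 ∉ 𝔮 := pow_not_mem 𝔮 hs2 2
  have h2 : (2 : MvPolynomial (Fin 4) K) ∉ 𝔮 := two_not_mem (K := K) 𝔮
  have h4 : (4 : MvPolynomial (Fin 4) K) ∉ 𝔮 := by
    have := natCast_not_mem (K := K) 𝔮 (m := 4) (by decide)
    exact_mod_cast this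
  have e10 := f_ne K (i := 1) (j := 0) (by decide)
  have e12 := f_ne K (i := 1) (j := 2) (by decide)
  have e13 := f_ne K (i := 1) (j := 3) (by decide)
  have e20 := f_ne K (i := 2) (j := 0) (by decide)
  have e21 := f_ne K (i := 2) (j := 1) (by decide)
  have e23 := f_ne K (i := 2) (j := 3) (by decide)
  have e30 := f_ne K (i := 3) (j := 0) (by decide)
  have e31 := f_ne K (i := 3) (j := 1) (by decide)
  have e32 := f_ne K (i := 3) (j := 2) (by decide)
  have e11 := f_self K 1
  have e22 := f_self K 2
  have e33 := f_self K 3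
  -- t
  have d1 : pderiv 1 (X 0 ^ 3 + X 1 ^ 4 + X 2 ^ 2 * X 3 ^ 2 : MvPolynomial (Fin 4) K) = 4 * X 1 ^ 3 := by
    simp only [map_add, Derivation.leibniz, Derivation.leibniz_pow, smul_eq_mul, nsmul_eq_mul, e10, e11, e12, e13]
    push_cast; ring
  have hX1 : (X 1 : MvPolynomial (Fin 4) K) ∈ 𝔮 := by
    have := sq_mul_deriv_mem_pow 𝔮 h (pderiv 1)
    rw [d1] at this
    exact mem_of_mul_mul_pow_mem_pow 𝔮 two_ne_zero hs2 h4 this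
  -- u
  have d3 : pderiv 3 (X 0 ^ 3 + X 1 ^ 4 + X 2 ^ 2 * X 3 ^ 2 : MvPolynomial (Fin 4) K) = 2 * (X 2 ^ 2 * X 3) := by
    simp only [map_add, Derivation.leibniz, Derivation.leibniz_pow, smul_eq_mul, nsmul_eq_mul, e30, e31, e32, e33]
    push_cast; ring
  have d33 : pderiv 3 (2 * (X 2 ^ 2 * X 3) : MvPolynomial (Fin 4) K) = 2 * X 2 ^ 2 := by
    simp only [Derivation.leibniz, Derivation.leibniz_pow, smul_eq_mul, nsmul_eq_mul, e32, e33, f_two]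
    push_cast; ring
  have hX2 : (X 2 : MvPolynomial (Fin 4) K) ∈ 𝔮 := by
    have h1 := sq_mul_deriv_mem_pow 𝔮 h (pderiv 3)
    rw [d3] at h1
    have h2' := sq_mul_deriv_mem_pow 𝔮 h1 (pderiv 3)
    rw [d33] at h2'
    exact mem_of_mul_mul_pow_mem_pow 𝔮 one_ne_zero hs4 h2 h2'
  -- w
  have d2 : pderiv 2 (X 0 ^ 3 + X 1 ^ 4 + X 2 ^ 2 * X 3 ^ 2 : MvPolynomial (Fin 4) K) = 2 * (X 3 ^ 2 * X 2) := by
    simp only [map_add, Derivation.leibniz, Derivation.leibniz_pow, smul_eq_mul, nsmul_eq_mul, e20, e21, e22, e23]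
    push_cast; ring
  have d22 : pderiv 2 (2 * (X 3 ^ 2 * X 2) : MvPolynomial (Fin 4) K) = 2 * X 3 ^ 2 := by
    simp only [Derivation.leibniz, Derivation.leibniz_pow, smul_eq_mul, nsmul_eq_mul, e22, e23, f_two]
    push_cast; ring
  have hX3 : (X 3 : MvPolynomial (Fin 4) K) ∈ 𝔮 := by
    have h1 := sq_mul_deriv_mem_pow 𝔮 h (pderiv 2)
    rw [d2] at h1
    have h2' := sq_mul_deriv_mem_pow 𝔮 h1 (pderiv 2)
    rw [d22] at h2'
    exact mem_of_mul_mul_pow_mem_pow 𝔮 one_ne_zero hs4 h2 h2'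
  -- z
  have hf : (X 0 ^ 3 + X 1 ^ 4 + X 2 ^ 2 * X 3 ^ 2 : MvPolynomial (Fin 4) K) ∈ 𝔮 :=
    (‹𝔮.IsPrime›.mem_or_mem (Ideal.pow_le_self three_ne_zero h)).resolve_left hs
  have hX0 : (X 0 : MvPolynomial (Fin 4) K) ∈ 𝔮 := by
    refine ‹𝔮.IsPrime›.mem_of_pow_mem 3 ?_
    have := Ideal.sub_mem _ hf (Ideal.add_mem _ (Ideal.pow_mem_of_mem 𝔮 hX1 4 (by norm_num))
      (Ideal.mul_mem_right (X 3 ^ 2) _ (Ideal.pow_mem_of_mem 𝔮 hX2 2 (by norm_num))))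
    rwa [show (X 0 ^ 3 + X 1 ^ 4 + X 2 ^ 2 * X 3 ^ 2 - (X 1 ^ 4 + X 2 ^ 2 * X 3 ^ 2) : MvPolynomial (Fin 4) K) = X 0 ^ 3
      by ring] at this
  exact ⟨hX0, hX1, hX2, hX3⟩

/-- **R2 (II), chart `u`** (`f'ᵤ = z'³ + u(w'² + t'⁴)`, `0 = z', 1 = t', 2 = u, 3 = w'`): a prime `𝔫 ∋ u` of order
`≥ 3` contains
`z', t', w'` too — the ONLY near point in the chart is its origin (`∂_u f' = w'² + t'⁴`, `∂_{w'}` of it `= 2w'`).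
[new; elementary] [folklore] -/
theorem R2_near_chart_u_only [CharP K 3] (𝔫 : Ideal (MvPolynomial (Fin 4) K)) [𝔫.IsPrime]
    (hu : (X 2 : MvPolynomial (Fin 4) K) ∈ 𝔫) {s : MvPolynomial (Fin 4) K} (hs : s ∉ 𝔫)
    (h : s * (X 0 ^ 3 + X 2 * (X 3 ^ 2 + X 1 ^ 4) : MvPolynomial (Fin 4) K) ∈ 𝔫 ^ 3) :
    (X 0 : MvPolynomial (Fin 4) K) ∈ 𝔫 ∧ (X 1 : MvPolynomial (Fin 4) K) ∈ 𝔫 ∧ (X 3 : MvPolynomial (Fin 4) K) ∈ 𝔫 := by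
  have hs2 : s ^ 2 ∉ 𝔫 := pow_not_mem 𝔫 hs 2
  have hs4 : (s ^ 2) ^ 2 ∉ 𝔫 := pow_not_mem 𝔫 hs2 2
  have h2 : (2 : MvPolynomial (Fin 4) K) ∉ 𝔫 := two_not_mem (K := K) 𝔫
  have e20 := f_ne K (i := 2) (j := 0) (by decide)
  have e21 := f_ne K (i := 2) (j := 1) (by decide)
  have e23 := f_ne K (i := 2) (j := 3) (by decide)
  have e31 := f_ne K (i := 3) (j := 1) (by decide)
  have e22 := f_self K 2
  have e33 := f_self K 3
  have d2 : pderiv 2 (X 0 ^ 3 + X 2 * (X 3 ^ 2 + X 1 ^ 4) : MvPolynomial (Fin 4) K) = X 3 ^ 2 + X 1 ^ 4 := by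
    simp only [map_add, Derivation.leibniz, Derivation.leibniz_pow, smul_eq_mul, nsmul_eq_mul, e20, e21, e22, e23]
    push_cast; ring
  have d3 : pderiv 3 (X 3 ^ 2 + X 1 ^ 4 : MvPolynomial (Fin 4) K) = 2 * X 3 ^ 1 := by
    simp only [map_add, Derivation.leibniz_pow, smul_eq_mul, nsmul_eq_mul, e31, e33]
    push_cast; ring
  have h1 := sq_mul_deriv_mem_pow 𝔫 h (pderiv 2)
  rw [d2] at h1
  have hX3 : (X 3 : MvPolynomial (Fin 4) K) ∈ 𝔫 := by
    have h2' := sq_mul_deriv_mem_pow 𝔫 h1 (pderiv 3)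
    rw [d3] at h2'
    exact mem_of_mul_mul_pow_mem_pow 𝔫 one_ne_zero hs4 h2 h2'
  have hX1 : (X 1 : MvPolynomial (Fin 4) K) ∈ 𝔫 := by
    have h1' : s ^ 2 * (X 3 ^ 2 + X 1 ^ 4) ∈ 𝔫 := Ideal.pow_le_self two_ne_zero h1
    have h3 : s ^ 2 * (1 * X 1 ^ 4) ∈ 𝔫 ^ 1 := by
      rw [pow_one]
      have := Ideal.sub_mem _ h1' (Ideal.mul_mem_left _ (s ^ 2) (Ideal.pow_mem_of_mem 𝔫 hX3 2 (by norm_num)))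
      rwa [show s ^ 2 * (X 3 ^ 2 + X 1 ^ 4) - s ^ 2 * X 3 ^ 2 = s ^ 2 * (1 * X 1 ^ 4) by ring] at this
    have h1n : (1 : MvPolynomial (Fin 4) K) ∉ 𝔫 := fun h1 => ‹𝔫.IsPrime›.ne_top ((Ideal.eq_top_iff_one _).2 h1)
    exact mem_of_mul_mul_pow_mem_pow 𝔫 one_ne_zero hs2 h1n h3
  have hf : (X 0 ^ 3 + X 2 * (X 3 ^ 2 + X 1 ^ 4) : MvPolynomial (Fin 4) K) ∈ 𝔫 :=
    (‹𝔫.IsPrime›.mem_or_mem (Ideal.pow_le_self three_ne_zero h)).resolve_left hs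
  have hX0 : (X 0 : MvPolynomial (Fin 4) K) ∈ 𝔫 := by
    refine ‹𝔫.IsPrime›.mem_of_pow_mem 3 ?_
    have := Ideal.sub_mem _ hf (Ideal.mul_mem_right (X 3 ^ 2 + X 1 ^ 4) _ hu)
    rwa [show (X 0 ^ 3 + X 2 * (X 3 ^ 2 + X 1 ^ 4) - X 2 * (X 3 ^ 2 + X 1 ^ 4) : MvPolynomial (Fin 4) K) = X 0 ^ 3 by ring] at this
  exact ⟨hX0, hX1, hX3⟩

/-- **R2 (II), chart `w`** (`f'_w = z'³ + w(u'² + t'⁴)`, `0 = z', 1 = t', 2 = u', 3 = w`; mirror of chart `u`): the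
only near point is
the chart origin. [new; elementary] [folklore] -/
theorem R2_near_chart_w_only [CharP K 3] (𝔫 : Ideal (MvPolynomial (Fin 4) K)) [𝔫.IsPrime]
    (hw : (X 3 : MvPolynomial (Fin 4) K) ∈ 𝔫) {s : MvPolynomial (Fin 4) K} (hs : s ∉ 𝔫)
    (h : s * (X 0 ^ 3 + X 3 * (X 2 ^ 2 + X 1 ^ 4) : MvPolynomial (Fin 4) K) ∈ 𝔫 ^ 3) :
    (X 0 : MvPolynomial (Fin 4) K) ∈ 𝔫 ∧ (X 1 : MvPolynomial (Fin 4) K) ∈ 𝔫 ∧ (X 2 : MvPolynomial (Fin 4) K) ∈ 𝔫 := by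
  have hs2 : s ^ 2 ∉ 𝔫 := pow_not_mem 𝔫 hs 2
  have hs4 : (s ^ 2) ^ 2 ∉ 𝔫 := pow_not_mem 𝔫 hs2 2
  have h2 : (2 : MvPolynomial (Fin 4) K) ∉ 𝔫 := two_not_mem (K := K) 𝔫
  have e30 := f_ne K (i := 3) (j := 0) (by decide)
  have e31 := f_ne K (i := 3) (j := 1) (by decide)
  have e32 := f_ne K (i := 3) (j := 2) (by decide)
  have e21 := f_ne K (i := 2) (j := 1) (by decide)
  have e22 := f_self K 2
  have e33 := f_self K 3
  have d3 : pderiv 3 (X 0 ^ 3 + X 3 * (X 2 ^ 2 + X 1 ^ 4) : MvPolynomial (Fin 4) K) = X 2 ^ 2 + X 1 ^ 4 := by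
    simp only [map_add, Derivation.leibniz, Derivation.leibniz_pow, smul_eq_mul, nsmul_eq_mul, e30, e31, e32, e33]
    push_cast; ring
  have d2 : pderiv 2 (X 2 ^ 2 + X 1 ^ 4 : MvPolynomial (Fin 4) K) = 2 * X 2 ^ 1 := by
    simp only [map_add, Derivation.leibniz_pow, smul_eq_mul, nsmul_eq_mul, e21, e22]
    push_cast; ring
  have h1 := sq_mul_deriv_mem_pow 𝔫 h (pderiv 3)
  rw [d3] at h1
  have hX2 : (X 2 : MvPolynomial (Fin 4) K) ∈ 𝔫 := by
    have h2' := sq_mul_deriv_mem_pow 𝔫 h1 (pderiv 2)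
    rw [d2] at h2'
    exact mem_of_mul_mul_pow_mem_pow 𝔫 one_ne_zero hs4 h2 h2'
  have hX1 : (X 1 : MvPolynomial (Fin 4) K) ∈ 𝔫 := by
    have h1' : s ^ 2 * (X 2 ^ 2 + X 1 ^ 4) ∈ 𝔫 := Ideal.pow_le_self two_ne_zero h1
    have h3 : s ^ 2 * (1 * X 1 ^ 4) ∈ 𝔫 ^ 1 := by
      rw [pow_one]
      have := Ideal.sub_mem _ h1' (Ideal.mul_mem_left _ (s ^ 2) (Ideal.pow_mem_of_mem 𝔫 hX2 2 (by norm_num)))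
      rwa [show s ^ 2 * (X 2 ^ 2 + X 1 ^ 4) - s ^ 2 * X 2 ^ 2 = s ^ 2 * (1 * X 1 ^ 4) by ring] at this
    have h1n : (1 : MvPolynomial (Fin 4) K) ∉ 𝔫 := fun h1 => ‹𝔫.IsPrime›.ne_top ((Ideal.eq_top_iff_one _).2 h1)
    exact mem_of_mul_mul_pow_mem_pow 𝔫 one_ne_zero hs2 h1n h3
  have hf : (X 0 ^ 3 + X 3 * (X 2 ^ 2 + X 1 ^ 4) : MvPolynomial (Fin 4) K) ∈ 𝔫 :=
    (‹𝔫.IsPrime›.mem_or_mem (Ideal.pow_le_self three_ne_zero h)).resolve_left hs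
  have hX0 : (X 0 : MvPolynomial (Fin 4) K) ∈ 𝔫 := by
    refine ‹𝔫.IsPrime›.mem_of_pow_mem 3 ?_
    have := Ideal.sub_mem _ hf (Ideal.mul_mem_right (X 2 ^ 2 + X 1 ^ 4) _ hw)
    rwa [show (X 0 ^ 3 + X 3 * (X 2 ^ 2 + X 1 ^ 4) - X 3 * (X 2 ^ 2 + X 1 ^ 4) : MvPolynomial (Fin 4) K) = X 0 ^ 3 by ring] at this
  exact ⟨hX0, hX1, hX2⟩

/-- **R2 (II), chart `t`** (`f'_t = z'³ + t(1 + u'²w'²)`, `0 = z', 1 = t, 2 = u', 3 = w'`): NO near point — at every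
prime `𝔫 ∋ t`,
`ord_𝔫 f'_t ≤ 2` (`∂_t f' = 1 + u'²w'² ∈ 𝔫`, `∂_{u'}` of it `= 2u'w'²` forces `u'w' ∈ 𝔫`, whence `1 ∈ 𝔫`). [new;
elementary] [folklore] -/
theorem R2_noNear_chart_t [CharP K 3] (𝔫 : Ideal (MvPolynomial (Fin 4) K)) [𝔫.IsPrime]
    (_ht : (X 1 : MvPolynomial (Fin 4) K) ∈ 𝔫) {s : MvPolynomial (Fin 4) K} (hs : s ∉ 𝔫) :
    s * (X 0 ^ 3 + X 1 * (1 + X 2 ^ 2 * X 3 ^ 2) : MvPolynomial (Fin 4) K) ∉ 𝔫 ^ 3 := by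
  intro h
  have hs2 : s ^ 2 ∉ 𝔫 := pow_not_mem 𝔫 hs 2
  have hs4 : (s ^ 2) ^ 2 ∉ 𝔫 := pow_not_mem 𝔫 hs2 2
  have h2 : (2 : MvPolynomial (Fin 4) K) ∉ 𝔫 := two_not_mem (K := K) 𝔫
  have e10 := f_ne K (i := 1) (j := 0) (by decide)
  have e12 := f_ne K (i := 1) (j := 2) (by decide)
  have e13 := f_ne K (i := 1) (j := 3) (by decide)
  have e23 := f_ne K (i := 2) (j := 3) (by decide)
  have e11 := f_self K 1
  have e22 := f_self K 2
  have d1 : pderiv 1 (X 0 ^ 3 + X 1 * (1 + X 2 ^ 2 * X 3 ^ 2) : MvPolynomial (Fin 4) K) = 1 + X 2 ^ 2 * X 3 ^ 2 := by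
    simp only [map_add, Derivation.leibniz, Derivation.leibniz_pow, smul_eq_mul, nsmul_eq_mul, e10, e11, e12, e13, f_one]
    push_cast; ring
  have d2 : pderiv 2 (1 + X 2 ^ 2 * X 3 ^ 2 : MvPolynomial (Fin 4) K) = 2 * (X 3 ^ 2 * X 2) ^ 1 := by
    simp only [map_add, Derivation.leibniz, Derivation.leibniz_pow, smul_eq_mul, nsmul_eq_mul, e22, e23, f_one]
    push_cast; ring
  have h1 := sq_mul_deriv_mem_pow 𝔫 h (pderiv 1)
  rw [d1] at h1
  have hg : (1 + X 2 ^ 2 * X 3 ^ 2 : MvPolynomial (Fin 4) K) ∈ 𝔫 :=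
    (‹𝔫.IsPrime›.mem_or_mem (Ideal.pow_le_self two_ne_zero h1)).resolve_left hs2
  have h2' := sq_mul_deriv_mem_pow 𝔫 h1 (pderiv 2)
  rw [d2] at h2'
  have huw : (X 3 ^ 2 * X 2 : MvPolynomial (Fin 4) K) ∈ 𝔫 := mem_of_mul_mul_pow_mem_pow 𝔫 one_ne_zero hs4 h2 h2'
  have huw' : (X 2 ^ 2 * X 3 ^ 2 : MvPolynomial (Fin 4) K) ∈ 𝔫 := by
    have := Ideal.mul_mem_left 𝔫 (X 2) huw
    rwa [show (X 2 : MvPolynomial (Fin 4) K) * (X 3 ^ 2 * X 2) = X 2 ^ 2 * X 3 ^ 2 by ring] at this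
  have h1mem : (1 : MvPolynomial (Fin 4) K) ∈ 𝔫 := by
    have := Ideal.sub_mem _ hg huw'
    rwa [add_sub_cancel_right] at this
  exact ‹𝔫.IsPrime›.ne_top ((Ideal.eq_top_iff_one _).2 h1mem)

/-- **R2 (II), chart `z`** (`f'_z = 1 + z(t'⁴ + u'²w'²)`, `0 = z, 1 = t', 2 = u', 3 = w'`): NO near point (`f'_z` is
a unit along
the exceptional divisor). [new; elementary] [folklore] -/
theorem R2_noNear_chart_z (𝔫 : Ideal (MvPolynomial (Fin 4) K)) [𝔫.IsPrime]
    (hz : (X 0 : MvPolynomial (Fin 4) K) ∈ 𝔫) {s : MvPolynomial (Fin 4) K} (hs : s ∉ 𝔫) :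
    s * (1 + X 0 * (X 1 ^ 4 + X 2 ^ 2 * X 3 ^ 2) : MvPolynomial (Fin 4) K) ∉ 𝔫 ^ 3 := by
  intro h
  have hf : (1 + X 0 * (X 1 ^ 4 + X 2 ^ 2 * X 3 ^ 2) : MvPolynomial (Fin 4) K) ∈ 𝔫 :=
    (‹𝔫.IsPrime›.mem_or_mem (Ideal.pow_le_self three_ne_zero h)).resolve_left hs
  have h1mem : (1 : MvPolynomial (Fin 4) K) ∈ 𝔫 := by
    have := Ideal.sub_mem _ hf (Ideal.mul_mem_right (X 1 ^ 4 + X 2 ^ 2 * X 3 ^ 2) _ hz)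
    rwa [add_sub_cancel_right] at this
  exact ‹𝔫.IsPrime›.ne_top ((Ideal.eq_top_iff_one _).2 h1mem)

end ChainCertificates

end Summit.ResolutionOfSingularities.ResolutionOfSingularities.Theorems.DeltaCutClasses
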